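import Summits.ResolutionOfSingularities.ResolutionOfSingularities.Theorems.WildConesCampaignW46SurfacesProof
import Summits.ResolutionOfSingularities.ResolutionOfSingularities.Theorems.WildConesCampaignW46ThreefoldsCharTwoProof

/-!
# [OURS · L1 W4.6, rung (i) — helper 1/3 of `…CampaignW46SurfacesMuDrop`] Elementary lemmas on `κ⟦X₀,X₁⟧`
# for the look-ahead-free Milnor drop: a generic scalar, the transversality functional, the slice bound
# for the intersection with the exceptional line, and `dim_κ R/𝔪ᵖ ≥ p + 2`

Cell res-hironaka (LADDER-RESOLUTION rung L, D-0089), slot W4.6, seat res-L1-s46-pv-2. Host: route `WildCones`,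
crux `ClassicalRegimes` (stmt-ResolutionOfSingularities-16884), `--supports … --as helper`. Everything here is OURS
and elementary commutative algebra on `R = κ⟦X₀,X₁⟧` (no statement of H. Hironaka's manuscript, no FACT-LIST
premise); it is consumed by `Theorems/WildConesCampaignW46SurfacesMuDropIntertwiner.lean` (the intrinsic
Huneke–Swanson inequality) and `Theorems/WildConesCampaignW46SurfacesMuDrop.lean` (the theorem
`campaignW46HypersurfacesMuDrop_surface : CampaignW46HypersurfacesMuDrop p 2` for every prime `p`). AI review
is weaker than expert review.

* `exists_generic_scalar` — over an INFINITE field, for coefficients `v` not all zero in degrees `≤ r` and any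
  `t`: some `μ` with `Σ_{l ≤ r} v l (−μ)^{r−l} ≠ 0` and `1 + μ t ≠ 0`;
* `sum_coeff_shear_eq_zero` — the functional `f ↦ Σ_l coeff_{(r−l, l)} f · (−μ)^{r−l}` vanishes on
  `(X i + μ X j) R + 𝔪ʳ⁺¹`;
* `finrank_quotient_span_sup_span_X_le_of_coeff_ne_zero` — if the `X i`-free slice of `D` has a non-zero
  coefficient in degree `≤ N` then `dim_κ R/((D) + (X i)) ≤ N`;
* `add_two_le_finrank_quotient_maximalIdeal_pow` — `dim_κ R/𝔪ᵖ ≥ p + 2` for `p ≥ 3`.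
-/

noncomputable section

-- single-problem summit: the doubled namespace component `ResolutionOfSingularities` is forced
set_option linter.dupNamespace false

open scoped BigOperators Classical
open MvPowerSeries IsLocalRing Finsupp Module
open Literature.RingTheory.MvPowerSeries.Jets Literature.RingTheory.Length
open Literature.AlgebraicGeometry.Resolution.PlaneChart

namespace Summit.ResolutionOfSingularities.ResolutionOfSingularities.Theorems

namespace CampaignW46.SurfacesMuDrop

open WildCones

variable {κ : Type} [Field κ]

/-! ## 1. Elementary lemmas on `κ⟦X₀, X₁⟧` -/

/-- In `Fin 2` with `j ≠ i`, a sum over all indices is the `i`-term plus the `j`-term. [folklore] -/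
theorem sum_univ_two_eq {i j : Fin 2} (hij : j ≠ i) {M : Type*} [AddCommMonoid M] (g : Fin 2 → M) :
    ∑ m, g m = g i + g j := by
  fin_cases i <;> fin_cases j <;> simp_all [Fin.sum_univ_two, add_comm]

/-- **A generic scalar** (infinite field): for a coefficient vector `v` with some `v l ≠ 0`, `l ≤ r`,
and any `t`, there is `λ` with `Σ_{l ≤ r} v l (-λ)^{r-l} ≠ 0` and `1 + λ t ≠ 0` (a non-zero polynomial
over an infinite field has a non-root). [folklore] -/
theorem exists_generic_scalar [Infinite κ] (v : ℕ → κ) (r : ℕ) (hv : ∃ l, l ≤ r ∧ v l ≠ 0) (t : κ) :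
    ∃ μ : κ, (∑ l ∈ Finset.range (r + 1), v l * (-μ) ^ (r - l)) ≠ 0 ∧ 1 + μ * t ≠ 0 := by
  obtain ⟨l₀, hl₀, hv₀⟩ := hv
  -- the polynomial `Q(s) = Σ v l (-1)^{r-l} s^{r-l}` is non-zero (coefficient of `s^{r-l₀}`)
  set Q : Polynomial κ := ∑ l ∈ Finset.range (r + 1),
    Polynomial.C (v l * (-1) ^ (r - l)) * Polynomial.X ^ (r - l) with hQ
  have hQeval : ∀ s : κ, Q.eval s = ∑ l ∈ Finset.range (r + 1), v l * (-s) ^ (r - l) := by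
    intro s
    rw [hQ, Polynomial.eval_finsetSum]
    refine Finset.sum_congr rfl fun l _ => ?_
    rw [Polynomial.eval_mul, Polynomial.eval_C, Polynomial.eval_pow, Polynomial.eval_X, neg_pow s, mul_assoc]
  have hQne : Q ≠ 0 := by
    intro h0
    have hc : Q.coeff (r - l₀) = v l₀ * (-1) ^ (r - l₀) := by
      rw [hQ, Polynomial.finsetSum_coeff]
      rw [Finset.sum_eq_single l₀]
      · rw [Polynomial.coeff_C_mul_X_pow, if_pos rfl]
      · intro l hl hne
        rw [Polynomial.coeff_C_mul_X_pow, if_neg]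
        rw [Finset.mem_range] at hl
        omega
      · intro h; exact absurd (Finset.mem_range.mpr (by omega)) h
    rw [h0, Polynomial.coeff_zero] at hc
    exact hv₀ (by
      have h1 : v l₀ * (-1) ^ (r - l₀) = 0 := hc.symm
      rcases mul_eq_zero.mp h1 with h | h
      · exact h
      · exact absurd h (pow_ne_zero _ (neg_ne_zero.mpr one_ne_zero)))
  -- the polynomial `1 + t s` is non-zero
  set P : Polynomial κ := Polynomial.C 1 + Polynomial.C t * Polynomial.X with hP
  have hPne : P ≠ 0 := by
    intro h0
    have := congrArg (Polynomial.coeff · 0) h0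
    simp [hP] at this
  have hprod : Q * P ≠ 0 := mul_ne_zero hQne hPne
  -- a non-root of the product
  by_contra hall
  push Not at hall
  apply hprod
  refine Polynomial.funext fun s => ?_
  rw [Polynomial.eval_mul, Polynomial.eval_zero]
  by_cases h1 : Q.eval s = 0
  · rw [h1, zero_mul]
  · have h2 : 1 + s * t = 0 := hall s (by rwa [hQeval] at h1)
    have hPs : P.eval s = 0 := by
      rw [hP, Polynomial.eval_add, Polynomial.eval_C, Polynomial.eval_mul, Polynomial.eval_C,
        Polynomial.eval_X, mul_comm t s]
      exact h2
    rw [hPs, mul_zero]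

/-- **The transversality functional vanishes on `(X i + μ X j) R + 𝔪ʳ⁺¹`**: evaluating the degree-`r`
part at `(X i, X j) = (-μ, 1)` kills every multiple of `X i + μ X j` and everything of order `> r`.
[folklore] -/
theorem sum_coeff_shear_eq_zero {i j : Fin 2} (hij : j ≠ i) (μ : κ) (r : ℕ)
    (w h : MvPowerSeries (Fin 2) κ) (hh : h ∈ maximalIdeal (MvPowerSeries (Fin 2) κ) ^ (r + 1)) :
    ∑ l ∈ Finset.range (r + 1),
      coeff (single i (r - l) + single j l) ((X i + C μ * X j) * w + h) * (-μ) ^ (r - l) = 0 := by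
  -- the coefficients of `w` along the degree-`(r-1)` diagonal
  set a : ℕ → κ := fun l => coeff (single i (r - 1 - l) + single j l) w with ha
  have hdeg : ∀ l, l ≤ r → (single i (r - l) + single j l : Fin 2 →₀ ℕ).degree = r := by
    intro l hl
    rw [map_add, degree_single, degree_single]; omega
  -- termwise evaluation
  have key : ∀ l ∈ Finset.range (r + 1),
      coeff (single i (r - l) + single j l) ((X i + C μ * X j) * w + h) * (-μ) ^ (r - l) =
        (if l < r then a l * (-μ) ^ (r - 1 - l) * (-μ) else 0) +
          (if 0 < l then μ * a (l - 1) * (-μ) ^ (r - l) else 0) := by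
    intro l hl
    rw [Finset.mem_range] at hl
    have hh0 : coeff (single i (r - l) + single j l) h = 0 :=
      coeff_eq_zero_of_mem_maximalIdeal_pow hh (by rw [hdeg l (by omega)]; omega)
    rw [map_add, hh0, add_zero, add_mul, map_add, mul_assoc (C μ), MvPowerSeries.coeff_C_mul]
    -- the `X i`-term
    have hA : coeff (single i (r - l) + single j l) (X i * w) =
        if l < r then a l else 0 := by
      split_ifs with hlr
      · have he : (single i (r - l) + single j l : Fin 2 →₀ ℕ) =
            single i 1 + (single i (r - 1 - l) + single j l) := by
          rw [← add_assoc, ← single_add]; congr 2; omega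
        rw [he, ← pow_one (X i : MvPowerSeries (Fin 2) κ), coeff_single_add_X_pow_mul]
      · have hl' : l = r := by omega
        rw [← pow_one (X i : MvPowerSeries (Fin 2) κ)]
        exact coeff_X_pow_succ_mul_eq_zero i (d := 0) (by rw [hl']; simp [hij.symm]) w
    -- the `X j`-term
    have hB : coeff (single i (r - l) + single j l) (X j * w) =
        if 0 < l then a (l - 1) else 0 := by
      split_ifs with hl0
      · have he : (single i (r - l) + single j l : Fin 2 →₀ ℕ) =
            single j 1 + (single i (r - 1 - (l - 1)) + single j (l - 1)) := by
          rw [add_left_comm, ← single_add]; congr 2 <;> omega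
        rw [he, ← pow_one (X j : MvPowerSeries (Fin 2) κ), coeff_single_add_X_pow_mul]
      · have hl' : l = 0 := by omega
        rw [← pow_one (X j : MvPowerSeries (Fin 2) κ)]
        exact coeff_X_pow_succ_mul_eq_zero j (d := 0) (by rw [hl']; simp [hij]) w
    rw [hA, hB]
    split_ifs with h1 h2 h2 <;> first
      | (rw [show r - l = (r - 1 - l) + 1 by omega, pow_succ]; ring)
      | ring
  rw [Finset.sum_congr rfl key, Finset.sum_add_distrib]
  -- first sum: drop the vanishing last term
  rw [Finset.sum_range_succ, if_neg (lt_irrefl r), add_zero]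
  -- second sum: drop the vanishing first term and shift
  rw [Finset.sum_range_succ', if_neg (lt_irrefl 0), add_zero]
  simp only [Nat.succ_pos', if_true, Nat.add_sub_cancel]
  rw [← Finset.sum_add_distrib]
  refine Finset.sum_eq_zero fun l hl => ?_
  rw [Finset.mem_range] at hl
  rw [if_pos hl, show r - (l + 1) = r - 1 - l by omega]
  ring

/-- **Intersection with the exceptional line is bounded by the slice**: if the `X i`-free slice of `D`
has a non-zero coefficient in degree `≤ N`, then `dim_κ R/((D) + (X i)) ≤ N`. [folklore] -/
theorem finrank_quotient_span_sup_span_X_le_of_coeff_ne_zero {i j : Fin 2} (hij : j ≠ i)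
    {D : MvPowerSeries (Fin 2) κ} {N : ℕ} (h : ∃ k, k ≤ N ∧ coeff (single j k) D ≠ 0) :
    finrank κ (MvPowerSeries (Fin 2) κ ⧸ (Ideal.span {D} ⊔ Ideal.span {(X i : MvPowerSeries (Fin 2) κ)})) ≤ N := by
  classical
  have hex : ∃ k, coeff (single j k) D ≠ 0 := by obtain ⟨k, -, hk⟩ := h; exact ⟨k, hk⟩
  set k₀ := Nat.find hex with hk₀
  have hk₀spec : coeff (single j k₀) D ≠ 0 := Nat.find_spec hex
  have hk₀min : ∀ k, k < k₀ → coeff (single j k) D = 0 := fun k hk => by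
    have := Nat.find_min hex hk
    simpa using this
  have hk₀N : k₀ ≤ N := by
    obtain ⟨k, hkN, hk⟩ := h
    exact (Nat.find_le hk).trans hkN
  set L : Ideal (MvPowerSeries (Fin 2) κ) :=
    Ideal.span {D} ⊔ Ideal.span {(X i : MvPowerSeries (Fin 2) κ)} with hL
  -- the `X i`-free part `D₀` of `D` and its factorisation `D₀ = X j ^ k₀ * V`
  let D₀ : MvPowerSeries (Fin 2) κ := fun e => if e i = 0 then coeff e D else 0
  let V : MvPowerSeries (Fin 2) κ := fun e => if e i = 0 then coeff (e + single j k₀) D else 0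
  have hD₀ : ∀ e : Fin 2 →₀ ℕ, coeff e D₀ = if e i = 0 then coeff e D else 0 := fun e => rfl
  have hV : ∀ e : Fin 2 →₀ ℕ, coeff e V = if e i = 0 then coeff (e + single j k₀) D else 0 := fun e => rfl
  have hdvd : (X i : MvPowerSeries (Fin 2) κ) ∣ D - D₀ := by
    rw [MvPowerSeries.X_dvd_iff]
    intro e he
    rw [map_sub, hD₀, if_pos he, sub_self]
  have hfac : D₀ = X j ^ k₀ * V := by
    ext e
    rw [hD₀, X_pow_eq, coeff_monomial_mul]
    by_cases hei : e i = 0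
    · rw [if_pos hei]
      by_cases hle : single j k₀ ≤ e
      · rw [if_pos hle, one_mul, hV, if_pos (by simp [hij.symm, hei] : (e - single j k₀) i = 0),
          tsub_add_cancel_of_le hle]
      · rw [if_neg hle]
        have hej : e j < k₀ := by
          by_contra hge
          apply hle
          intro m
          rcases OrdPExitSurface.eq_or_eq i j hij m with rfl | rfl
          · simp [hij.symm]
          · simp; omega
        have he' : e = single j (e j) := by
          conv_lhs => rw [eq_single_add_single hij e, hei, single_zero, zero_add]
        have h0 := hk₀min (e j) hej
        rw [← he'] at h0
        exact h0
    · rw [if_neg hei]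
      by_cases hle : single j k₀ ≤ e
      · rw [if_pos hle, one_mul, hV, if_neg (by simp [hij.symm]; exact hei)]
      · rw [if_neg hle]
  have hVu : IsUnit V := by
    rw [MvPowerSeries.isUnit_iff_constantCoeff, ← coeff_zero_eq_constantCoeff_apply, hV,
      if_pos (by simp), zero_add, isUnit_iff_ne_zero]
    exact hk₀spec
  -- `X j ^ k₀ ∈ L`
  have hD₀L : D₀ ∈ L := by
    obtain ⟨W, hW⟩ := hdvd
    have : D₀ = D - X i * W := by rw [← hW]; ring
    rw [this]
    exact Ideal.sub_mem _ (Ideal.mem_sup_left (Ideal.mem_span_singleton_self _))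
      (Ideal.mem_sup_right (Ideal.mem_span_singleton'.mpr ⟨W, by ring⟩))
  have hXjL : (X j : MvPowerSeries (Fin 2) κ) ^ k₀ ∈ L := by
    obtain ⟨u, hu⟩ := hVu
    have : (X j : MvPowerSeries (Fin 2) κ) ^ k₀ = D₀ * ↑u⁻¹ := by
      rw [hfac, ← hu, mul_assoc, Units.mul_inv, mul_one]
    rw [this]
    exact Ideal.mul_mem_right _ _ hD₀L
  -- `𝔪 ^ k₀ ≤ L`
  have hmL : maximalIdeal (MvPowerSeries (Fin 2) κ) ^ k₀ ≤ L := by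
    rw [maximalIdeal_pow_eq_span_monomial, Ideal.span_le]
    rintro _ ⟨e, he, rfl⟩
    rw [Set.mem_setOf_eq] at he
    change monomial e (1 : κ) ∈ L
    rw [monomial_one_eq_X_pow_mul_X_pow hij e]
    by_cases hei : e i = 0
    · have hej : e j = k₀ := by have := degree_eq_add hij e; omega
      rw [hei, pow_zero, one_mul, hej]
      exact hXjL
    · obtain ⟨k, hk⟩ := Nat.exists_eq_succ_of_ne_zero hei
      rw [hk, pow_succ, mul_assoc, mul_comm (X i), ← mul_assoc]
      exact Ideal.mul_mem_left _ _ (Ideal.mem_sup_right (Ideal.mem_span_singleton_self _))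
  haveI : Module.Finite κ (MvPowerSeries (Fin 2) κ ⧸ L) :=
    haveI := finite_quotient_maximalIdeal_pow (σ := Fin 2) (K := κ) k₀
    finite_quotient_of_le (κ := κ) hmL
  -- `R/L` is spanned by `1, X j, …, X j ^ (k₀ - 1)`
  have hsm : ∀ (c : κ) (y : MvPowerSeries (Fin 2) κ),
      Ideal.Quotient.mk L (C c * y) = c • Ideal.Quotient.mk L y := by
    intro c y
    rw [Algebra.smul_def, ← Ideal.Quotient.mk_algebraMap, ← map_mul, MvPowerSeries.c_eq_algebraMap]
  have hspan : Submodule.span κ (Set.range fun k : Fin k₀ =>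
      Ideal.Quotient.mk L ((X j : MvPowerSeries (Fin 2) κ) ^ (k : ℕ))) = ⊤ := by
    rw [eq_top_iff]
    rintro y -
    obtain ⟨f, rfl⟩ := Ideal.Quotient.mk_surjective y
    have hf : Ideal.Quotient.mk L f =
        Ideal.Quotient.mk L (↑(truncTotal k₀ f) : MvPowerSeries (Fin 2) κ) := by
      rw [Ideal.Quotient.eq]
      exact hmL (sub_coe_truncTotal_mem_maximalIdeal_pow k₀ f)
    rw [hf, (truncTotal k₀ f).as_sum, ← MvPolynomial.coeToMvPowerSeries.ringHom_apply, map_sum, map_sum]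
    refine Submodule.sum_mem _ fun e he => ?_
    rw [MvPolynomial.coeToMvPowerSeries.ringHom_apply, MvPolynomial.coe_monomial]
    have hdeg : e.degree < k₀ := by
      by_contra hN
      exact (MvPolynomial.mem_support_iff.1 he) (coeff_truncTotal_eq_zero _ (not_lt.mp hN))
    have hmon : monomial e (MvPolynomial.coeff e (truncTotal k₀ f)) =
        C (MvPolynomial.coeff e (truncTotal k₀ f)) *
          ((X i : MvPowerSeries (Fin 2) κ) ^ e i * X j ^ e j) := by
      rw [← monomial_one_eq_X_pow_mul_X_pow hij e, ← MvPowerSeries.monomial_zero_eq_C_apply,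
        monomial_mul_monomial, zero_add, mul_one]
    rw [hmon, hsm]
    refine Submodule.smul_mem _ _ ?_
    by_cases hei : e i = 0
    · have hlt : e j < k₀ := by have := degree_eq_add hij e; omega
      rw [hei, pow_zero, one_mul]
      exact Submodule.subset_span ⟨⟨e j, hlt⟩, rfl⟩
    · obtain ⟨k, hk⟩ := Nat.exists_eq_succ_of_ne_zero hei
      have h0 : Ideal.Quotient.mk L ((X i : MvPowerSeries (Fin 2) κ) ^ e i * X j ^ e j) = 0 := by
        rw [Ideal.Quotient.eq_zero_iff_mem, hk, pow_succ, mul_assoc, mul_comm (X i), ← mul_assoc]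
        exact Ideal.mul_mem_left _ _ (Ideal.mem_sup_right (Ideal.mem_span_singleton_self _))
      rw [h0]; exact Submodule.zero_mem _
  calc finrank κ (MvPowerSeries (Fin 2) κ ⧸ L)
      = finrank κ (⊤ : Submodule κ (MvPowerSeries (Fin 2) κ ⧸ L)) := (finrank_top κ _).symm
    _ = finrank κ (Submodule.span κ (Set.range fun k : Fin k₀ =>
          Ideal.Quotient.mk L ((X j : MvPowerSeries (Fin 2) κ) ^ (k : ℕ)))) := by rw [hspan]
    _ ≤ Fintype.card (Fin k₀) := finrank_range_le_card _
    _ = k₀ := Fintype.card_fin _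
    _ ≤ N := hk₀N

/-- `dim_κ κ⟦X₀,X₁⟧/𝔪ᵖ ≥ p + 2` for `p ≥ 3` (indeed `= p(p+1)/2`; two strict steps above
`dim R/(𝔪ᵖ + (X i)) ≥ p` suffice here). [folklore] -/
theorem add_two_le_finrank_quotient_maximalIdeal_pow {i j : Fin 2} (hij : j ≠ i) {p : ℕ} (hp : 3 ≤ p) :
    p + 2 ≤ finrank κ (MvPowerSeries (Fin 2) κ ⧸ maximalIdeal (MvPowerSeries (Fin 2) κ) ^ p) := by
  haveI : Module.Finite κ (MvPowerSeries (Fin 2) κ ⧸ maximalIdeal (MvPowerSeries (Fin 2) κ) ^ p) :=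
    finite_quotient_maximalIdeal_pow (σ := Fin 2) (K := κ) p
  set m : Ideal (MvPowerSeries (Fin 2) κ) := maximalIdeal (MvPowerSeries (Fin 2) κ) with hm
  -- no element of `𝔪ᵖ + (X i ^ 2)` has an `X i`-coefficient, none of `𝔪ᵖ` an `X i ^ 2`-coefficient
  have hc1 : ∀ g ∈ m ^ p ⊔ Ideal.span {(X i : MvPowerSeries (Fin 2) κ) ^ 2}, coeff (single i 1) g = 0 := by
    intro g hg
    rcases Submodule.mem_sup.mp hg with ⟨a, ha, b, hb, rfl⟩
    obtain ⟨q, rfl⟩ := Ideal.mem_span_singleton'.mp hb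
    rw [map_add, coeff_eq_zero_of_mem_maximalIdeal_pow ha (by rw [degree_single]; omega), zero_add,
      mul_comm, show (single i 1 : Fin 2 →₀ ℕ) = single i 1 from rfl]
    exact coeff_X_pow_succ_mul_eq_zero i (d := 1) (by simp) q
  have hc2 : ∀ g ∈ m ^ p, coeff (single i 2) g = 0 := fun g hg =>
    coeff_eq_zero_of_mem_maximalIdeal_pow hg (by rw [degree_single]; omega)
  have hlt1 : m ^ p < m ^ p ⊔ Ideal.span {(X i : MvPowerSeries (Fin 2) κ) ^ 2} := by
    refine lt_of_le_of_ne le_sup_left fun heq => ?_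
    have hmem : (X i : MvPowerSeries (Fin 2) κ) ^ 2 ∈ m ^ p := by
      rw [heq]; exact Ideal.mem_sup_right (Ideal.mem_span_singleton_self _)
    have := hc2 _ hmem
    rw [X_pow_eq, coeff_monomial, if_pos rfl] at this
    exact one_ne_zero this
  have hlt2 : m ^ p ⊔ Ideal.span {(X i : MvPowerSeries (Fin 2) κ) ^ 2} <
      m ^ p ⊔ Ideal.span {(X i : MvPowerSeries (Fin 2) κ)} := by
    refine lt_of_le_of_ne (sup_le le_sup_left ?_) fun heq => ?_
    · rw [Ideal.span_singleton_le_iff_mem]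
      exact Ideal.mem_sup_right (Ideal.mem_span_singleton'.mpr ⟨X i, by ring⟩)
    · have hmem : (X i : MvPowerSeries (Fin 2) κ) ∈ m ^ p ⊔ Ideal.span {(X i : MvPowerSeries (Fin 2) κ) ^ 2} := by
        rw [heq]; exact Ideal.mem_sup_right (Ideal.mem_span_singleton_self _)
      have := hc1 _ hmem
      rw [coeff_X, if_pos rfl] at this
      exact one_ne_zero this
  have h3 : p ≤ finrank κ (MvPowerSeries (Fin 2) κ ⧸ (m ^ p ⊔ Ideal.span {(X i : MvPowerSeries (Fin 2) κ)})) := by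
    obtain ⟨q, hq⟩ : ∃ q, p = q + 1 := ⟨p - 1, by omega⟩
    rw [hq]
    exact succ_le_finrank_quotient_pow_succ_sup_span hij q
  haveI : Module.Finite κ (MvPowerSeries (Fin 2) κ ⧸ (m ^ p ⊔ Ideal.span {(X i : MvPowerSeries (Fin 2) κ) ^ 2})) :=
    finite_quotient_of_le (κ := κ) le_sup_left
  have h1 := finrank_quotient_lt_of_lt (κ := κ) hlt1
  have h2' := finrank_quotient_lt_of_lt (κ := κ) hlt2
  omega

end CampaignW46.SurfacesMuDrop

end Summit.ResolutionOfSingularities.ResolutionOfSingularities.Theorems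

end
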